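import Summits.CriticalPhenomena.PercolationContinuityZ3.Theorems.PercNearOneGluingNoHeavyQuantSGCLightCellsNoLow
import Summits.CriticalPhenomena.PercolationContinuityZ3.Theorems.PercNearOneGluingNoHeavyQuantSGCLightPairPairTools
import HarnessLib

/-!
# QUANT lane R8, T-DEC, leg (III): cell PT of `SingleGateConvClosed` — the explicit seven-atom law `gate_q({lo₁,hi₁;γ₁} ∗ triple)`, and
# PT at the GIANT LAYERS of its residual (`j′ < lo₁ + s₂`) by criterion E from the triple's dominant-layer datum `y ≤ q(p₂ + p₃)`

builds on p205010 (kernel theorem, internal audit signed; external expert review pending)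

Support file (`--supports stmt-CriticalPhenomena-4575`), QUANT lane, seat prim-quant-arm-3 (gen 121), rung R8 of
`run/shared/lean/prim/quant/LADDER.md`.  Theorems only, standard axioms, no sorries, no definitions.  Companion of `…QuantSGCLightCellsNoLow`
(no-low regime, CW piece, `sgcLightPairTriple_of_windowMix_of_residual`).

* `LawDec.shift_TR_apply`, **`LawDec.gate_lconv_TP_TR_apply`** — `P = gate_q({lo₁, hi₁; γ₁} ∗ {s₁, s₂, s₃; p}) = (1−q)δ₀ +
  q[(1−γ₁)·{sₖ + lo₁; p} + γ₁·{sₖ + hi₁; p}]` explicitly (seven atoms; the bookkeeping entry point for certificate work on PT).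
* `LawDec.sum_range_TR` — mass of a three-atom law below a level.
* `LawDec.triple_tail_ge_of_decAt` — in PT's binder, if `2s₁ < q·T₂` then `y ≤ q(p₂ + p₃)` (`tail_ge_of_decAt` at the dominant layer `s₁` of
  the gated triple).
* **`LawDec.sgcLightPairTriple_decAt_of_lt_lo_s₂`** — PT's conclusion at every layer `j′ < lo₁ + s₂`: either no nonzero low
  (`sgcLightPairTriple_decAt_of_le`) or the lows `{0, lo₁+s₁ (, hi₁+s₁)}` carry at most `1 − q + q·p₁ ≤ 1 − y` while everything charged above
  `j′` is a giant — criterion E (`decAt_of_giantsAbsorbLows`).  EXACT CENSUS (arm-3 g121 `explore/pt_resid_E.py`): 93 of 466 sampled residual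
  layers of `…NoLow` are of this kind (all absorbers giants).
* **`LawDec.sgcLightPairTriple_of_windowMix_of_residual₂`** — `WindowMixDEC →` (PT on the smaller residual: as in
  `sgcLightPairTriple_of_windowMix_of_residual` AND `lo₁ + s₂ ≤ j′`) `→ SGCLightPairTriple`.
HONEST STATUS: PT (residual) / TT / L2 / L3 / CW / `SingleGateConvClosed` / `GateMove` / `TreeDEC` / `FarTreeRow` remain OPEN; nothing here
is a published result; RATE class log\* / honest sentence unchanged.

[this work]; criterion E: prim-quant-census-2 g52 (`…QuantLawDecAbsorb`); `tail_ge_of_decAt`: prim-quant-stmt g18; cells: prim-quant-stmt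
g30/g31 (this lane).  The gluing rows served [cite: KozmaNitzan2024, Conjecture 3 (p. 15)]; product measure [cite: Grimmett1999, §1.3 p. 10].
-/

noncomputable section

namespace Summit.CriticalPhenomena.PercolationContinuityZ3.Theorems

namespace Quant

open Finset

/-- two-point law notation `TP[lo, hi, g, h] = g·[h = hi] + (1 − g)·[h = lo]` (as in the lane's other files). -/
local notation3 "TP[" lo ", " hi ", " g ", " h "]" =>
  (g : ℝ) * (if (h : ℕ) = (hi : ℕ) then (1 : ℝ) else 0) + (1 - (g : ℝ)) * (if (h : ℕ) = (lo : ℕ) then (1 : ℝ) else 0)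

/-- three-atom law notation `TR[s₁, s₂, s₃, p₁, p₂, p₃, h] = p₁·[h = s₁] + p₂·[h = s₂] + p₃·[h = s₃]`. -/
local notation3 "TR[" s₁ ", " s₂ ", " s₃ ", " p₁ ", " p₂ ", " p₃ ", " h "]" =>
  (p₁ : ℝ) * (if (h : ℕ) = (s₁ : ℕ) then (1 : ℝ) else 0) + (p₂ : ℝ) * (if (h : ℕ) = (s₂ : ℕ) then (1 : ℝ) else 0)
    + (p₃ : ℝ) * (if (h : ℕ) = (s₃ : ℕ) then (1 : ℝ) else 0)

namespace LawDec

/-! ### The explicit law of cell PT -/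

/-- a shifted three-atom indicator: `[s ≤ h]·{s₁, s₂, s₃; p}(h − s) = {s₁ + s, s₂ + s, s₃ + s; p}(h)`. [folklore] -/
theorem shift_TR_apply (p₁ p₂ p₃ : ℝ) (s s₁ s₂ s₃ h : ℕ) :
    (if s ≤ h then TR[s₁, s₂, s₃, p₁, p₂, p₃, h - s] else 0) = TR[s₁ + s, s₂ + s, s₃ + s, p₁, p₂, p₃, h] := by
  by_cases hs : s ≤ h
  · rw [if_pos hs]
    have e1 : (h - s = s₁) ↔ (h = s₁ + s) := by omega
    have e2 : (h - s = s₂) ↔ (h = s₂ + s) := by omega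
    have e3 : (h - s = s₃) ↔ (h = s₃ + s) := by omega
    simp only [e1, e2, e3]
  · rw [if_neg hs, if_neg (by omega), if_neg (by omega), if_neg (by omega)]; ring

/-- **THE SEVEN ATOMS OF `gate_q({lo₁, hi₁; γ₁} ∗ {s₁, s₂, s₃; p})`**: the gate zero `1 − q` and the masses `q(1−γ₁)pₖ` at `sₖ + lo₁`,
`qγ₁pₖ` at `sₖ + hi₁` (atoms may coincide; `lo₁ ≤ hi₁ ≤ M₁`, `s₃ ≤ M₂`). [this work] -/
theorem gate_lconv_TP_TR_apply (q γ₁ p₁ p₂ p₃ : ℝ) (M₁ M₂ lo₁ hi₁ s₁ s₂ s₃ : ℕ) (hlo₁ : lo₁ ≤ hi₁) (hhi₁ : hi₁ ≤ M₁)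
    (h13 : s₁ ≤ s₃) (h23 : s₂ ≤ s₃) (h3 : s₃ ≤ M₂) (h : ℕ) :
    gate (lconv M₁ M₂ (fun k => TP[lo₁, hi₁, γ₁, k]) (fun k => TR[s₁, s₂, s₃, p₁, p₂, p₃, k])) q h =
      (1 - q) * (if h = 0 then (1 : ℝ) else 0) +
        q * ((1 - γ₁) * TR[s₁ + lo₁, s₂ + lo₁, s₃ + lo₁, p₁, p₂, p₃, h] + γ₁ * TR[s₁ + hi₁, s₂ + hi₁, s₃ + hi₁, p₁, p₂, p₃, h]) := by
  have h2M : ∀ k, M₂ < k → TR[s₁, s₂, s₃, p₁, p₂, p₃, k] = 0 := fun k hk => by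
    rw [if_neg (by omega), if_neg (by omega), if_neg (by omega)]; ring
  rw [gate_apply, lconv_comm, lconv_TP M₂ M₁ lo₁ hi₁ (fun k => TR[s₁, s₂, s₃, p₁, p₂, p₃, k]) γ₁ h2M (hlo₁.trans hhi₁) hhi₁ h,
    shift_TR_apply p₁ p₂ p₃ lo₁ s₁ s₂ s₃ h, shift_TR_apply p₁ p₂ p₃ hi₁ s₁ s₂ s₃ h]
  ring

/-- mass of a three-atom law strictly below the level `n`. [folklore] -/
theorem sum_range_TR (p₁ p₂ p₃ : ℝ) (a₁ a₂ a₃ n : ℕ) :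
    ∑ h ∈ Finset.range n, TR[a₁, a₂, a₃, p₁, p₂, p₃, h] =
      (if a₁ < n then p₁ else 0) + (if a₂ < n then p₂ else 0) + (if a₃ < n then p₃ else 0) := by
  rw [Finset.sum_add_distrib, Finset.sum_add_distrib, ← Finset.mul_sum, ← Finset.mul_sum, ← Finset.mul_sum,
    Finset.sum_ite_eq' (Finset.range n) a₁, Finset.sum_ite_eq' (Finset.range n) a₂, Finset.sum_ite_eq' (Finset.range n) a₃]
  simp only [Finset.mem_range]
  split_ifs <;> ring

/-- **THE TRIPLE'S DOMINANT-LAYER DATUM.**  If the gated triple `gate_q{s₁, s₂, s₃; p}` (`s₁ < s₂ < s₃ ≤ M₂`, `Σ pᵢ = 1`, mean `T₂`) is DEC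
at the layer `s₁` at floor `y ≤ 1` and `2s₁ < q·T₂`, then `y ≤ q(p₂ + p₃)` (`tail_ge_of_decAt`). [this work] -/
theorem triple_tail_ge_of_decAt (y q p₁ p₂ p₃ T₂ : ℝ) (M₂ s₁ s₂ s₃ : ℕ) (hy1 : y ≤ 1) (hq0 : 0 ≤ q) (hq1 : q ≤ 1)
    (h12 : s₁ < s₂) (h23 : s₂ < s₃) (h3 : s₃ ≤ M₂) (hp₁ : 0 ≤ p₁) (hp₂ : 0 ≤ p₂) (hp₃ : 0 ≤ p₃) (hp : p₁ + p₂ + p₃ = 1)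
    (hT : p₁ * (s₁ : ℝ) + p₂ * (s₂ : ℝ) + p₃ * (s₃ : ℝ) = T₂)
    (hD : DECAt y s₁ M₂ (gate (fun h => TR[s₁, s₂, s₃, p₁, p₂, p₃, h]) q)) (hlow : 2 * (s₁ : ℝ) < q * T₂) :
    y ≤ q * (p₂ + p₃) := by
  obtain ⟨b0, bM, b1, bmean⟩ := triple_laws' p₁ p₂ p₃ T₂ M₂ s₁ s₂ s₃ (by omega) (by omega) h3 hp₁ hp₂ hp₃ hp hT
  obtain ⟨n0, nM, n1⟩ := gate_laws M₂ (fun h => TR[s₁, s₂, s₃, p₁, p₂, p₃, h]) q hq0 hq1 b0 bM b1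
  have nmean : ∑ h ∈ Finset.range (M₂ + 1), (h : ℝ) * gate (fun h => TR[s₁, s₂, s₃, p₁, p₂, p₃, h]) q h = q * T₂ := by
    rw [sum_mul_gate, bmean]
  have htail := tail_ge_of_decAt y s₁ M₂ _ hy1 hD (by rw [nmean]; exact hlow)
  -- the tail above `s₁` is `q (p₂ + p₃)`: total mass `1` minus the mass `1 − q + q p₁` at or below `s₁`
  have hsplit := Finset.sum_range_add_sum_Ico (gate (fun h => TR[s₁, s₂, s₃, p₁, p₂, p₃, h]) q)
    (show s₁ + 1 ≤ M₂ + 1 by omega)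
  have hhead : ∑ h ∈ Finset.range (s₁ + 1), gate (fun h => TR[s₁, s₂, s₃, p₁, p₂, p₃, h]) q h = 1 - q + q * p₁ := by
    have e : ∀ h, gate (fun h => TR[s₁, s₂, s₃, p₁, p₂, p₃, h]) q h =
        q * TR[s₁, s₂, s₃, p₁, p₂, p₃, h] + (1 - q) * (if h = 0 then (1 : ℝ) else 0) := fun h => gate_apply _ q h
    simp_rw [e]
    rw [Finset.sum_add_distrib, ← Finset.mul_sum, ← Finset.mul_sum, sum_range_TR,
      Finset.sum_ite_eq' (Finset.range (s₁ + 1)) 0, if_pos (Finset.mem_range.2 (Nat.succ_pos s₁)),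
      if_pos (Nat.lt_succ_self s₁), if_neg (by omega), if_neg (by omega)]
    ring
  rw [n1, hhead] at hsplit
  have hq : q * p₁ + q * p₂ + q * p₃ = q := by linear_combination q * hp
  linarith

/-! ### PT at the giant layers of the residual -/

/-- **CELL PT AT THE LAYERS `j′ < lo₁ + s₂`.**  In PT's binder: if `t ≤ 2(lo₁ + s₁)` or `j′ < lo₁ + s₁` there is no nonzero low
(`sgcLightPairTriple_decAt_of_le`); otherwise `2s₁ < q·T₂` (as `q·T₁ ≤ 2lo₁`, `lightPair_two_lo_ge`), the triple's dominant-layer datum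
gives `y ≤ q(p₂ + p₃)`, the mass at or below `j′ < lo₁ + s₂` is at most `1 − q + q·p₁ ≤ 1 − y`, and criterion E
(`decAt_of_giantsAbsorbLows`) concludes. [this work] -/
theorem sgcLightPairTriple_decAt_of_lt_lo_s₂ (y q γ₁ p₁ p₂ p₃ T₂ : ℝ) (M₁ M₂ lo₁ hi₁ s₁ s₂ s₃ j' : ℕ)
    (hy0 : 0 < y) (hy1 : y < 1) (hq0 : 0 < q) (hq1 : q ≤ 1)
    (hlohi₁ : lo₁ < hi₁) (hhi₁ : hi₁ ≤ M₁) (hγ₁0 : 0 ≤ γ₁) (hγ₁1 : γ₁ ≤ 1) (hlight₁ : q * γ₁ < y)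
    (hta₁ : y * (M₁ : ℝ) ≤ q * ((lo₁ : ℝ) + ((hi₁ : ℝ) - lo₁) * γ₁))
    (hD₁ : ∀ j', j' < M₁ → DECAt y j' M₁ (gate (fun h => TP[lo₁, hi₁, γ₁, h]) q))
    (h12 : s₁ < s₂) (h23 : s₂ < s₃) (h3 : s₃ ≤ M₂) (hp₁ : 0 < p₁) (hp₂ : 0 < p₂) (hp₃ : 0 < p₃) (hp : p₁ + p₂ + p₃ = 1)
    (hT : p₁ * (s₁ : ℝ) + p₂ * (s₂ : ℝ) + p₃ * (s₃ : ℝ) = T₂) (hta₂ : y * (M₂ : ℝ) ≤ q * T₂)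
    (hD₂ : ∀ j', j' < M₂ → DECAt y j' M₂ (gate (fun h => TR[s₁, s₂, s₃, p₁, p₂, p₃, h]) q))
    (hj : j' < lo₁ + s₂) (hjM : j' < M₁ + M₂) :
    DECAt y j' (M₁ + M₂) (gate (lconv M₁ M₂ (fun h => TP[lo₁, hi₁, γ₁, h]) (fun h => TR[s₁, s₂, s₃, p₁, p₂, p₃, h])) q) := by
  by_cases hle : j' < lo₁ + s₁ ∨ q * (((lo₁ : ℝ) + ((hi₁ : ℝ) - lo₁) * γ₁) + T₂) ≤ 2 * ((lo₁ : ℝ) + s₁)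
  · exact sgcLightPairTriple_decAt_of_le y q γ₁ p₁ p₂ p₃ T₂ M₁ M₂ lo₁ hi₁ s₁ s₂ s₃ j' hy0 hy1 hq0 hq1 hlohi₁ hhi₁ hγ₁0 hγ₁1
      hta₁ h12 h23 h3 hp₁.le hp₂.le hp₃.le hp hT hta₂ hle
  -- a nonzero low is present: `2 s₁ < q T₂`
  have ht1 : 2 * ((lo₁ : ℝ) + s₁) < q * (((lo₁ : ℝ) + ((hi₁ : ℝ) - lo₁) * γ₁) + T₂) := by
    by_contra hc
    exact hle (Or.inr (not_lt.1 hc))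
  have h2lo := lightPair_two_lo_ge y q γ₁ M₁ lo₁ hi₁ hy1.le hlohi₁ hhi₁ hγ₁0 hγ₁1 hlight₁ hD₁
  have hs₁low : 2 * (s₁ : ℝ) < q * T₂ := by nlinarith
  have hHG := triple_tail_ge_of_decAt y q p₁ p₂ p₃ T₂ M₂ s₁ s₂ s₃ hy1.le hq0.le hq1 h12 h23 h3 hp₁.le hp₂.le hp₃.le hp hT
    (hD₂ s₁ (by omega)) hs₁low
  -- the product law and its mass at or below `j′`
  set P : ℕ → ℝ := gate (lconv M₁ M₂ (fun h => TP[lo₁, hi₁, γ₁, h]) (fun h => TR[s₁, s₂, s₃, p₁, p₂, p₃, h])) q with hP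
  obtain ⟨a0, aM, a1, -⟩ := tp_laws M₁ lo₁ hi₁ γ₁ hγ₁0 hγ₁1 hlohi₁.le hhi₁
  obtain ⟨b0, bM, b1, -⟩ := triple_laws' p₁ p₂ p₃ T₂ M₂ s₁ s₂ s₃ (by omega) (by omega) h3 hp₁.le hp₂.le hp₃.le hp hT
  obtain ⟨n0, nM, n1⟩ := gate_laws (M₁ + M₂) (lconv M₁ M₂ (fun h => TP[lo₁, hi₁, γ₁, h])
    (fun h => TR[s₁, s₂, s₃, p₁, p₂, p₃, h])) q hq0.le hq1 (lconv_nonneg M₁ M₂ _ _ a0 b0)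
    (fun k hk => lconv_eq_zero M₁ M₂ _ _ k hk) (sum_lconv M₁ M₂ _ _ a1 b1)
  have hhead : ∑ h ∈ Finset.range (j' + 1), P h ≤ 1 - q + q * p₁ := by
    have e : ∀ h, P h = (1 - q) * (if h = 0 then (1 : ℝ) else 0) +
        q * ((1 - γ₁) * TR[s₁ + lo₁, s₂ + lo₁, s₃ + lo₁, p₁, p₂, p₃, h] + γ₁ * TR[s₁ + hi₁, s₂ + hi₁, s₃ + hi₁, p₁, p₂, p₃, h]) :=
      fun h => gate_lconv_TP_TR_apply q γ₁ p₁ p₂ p₃ M₁ M₂ lo₁ hi₁ s₁ s₂ s₃ hlohi₁.le hhi₁ (h12.trans h23).le h23.le h3 h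
    simp_rw [e]
    rw [Finset.sum_add_distrib, ← Finset.mul_sum, ← Finset.mul_sum, Finset.sum_add_distrib, ← Finset.mul_sum, ← Finset.mul_sum,
      Finset.sum_ite_eq' (Finset.range (j' + 1)) 0, if_pos (Finset.mem_range.2 (Nat.succ_pos j')), sum_range_TR, sum_range_TR,
      if_neg (show ¬ s₂ + lo₁ < j' + 1 by omega), if_neg (show ¬ s₃ + lo₁ < j' + 1 by omega),
      if_neg (show ¬ s₂ + hi₁ < j' + 1 by omega), if_neg (show ¬ s₃ + hi₁ < j' + 1 by omega)]
    have i1 : (if s₁ + lo₁ < j' + 1 then p₁ else 0) ≤ p₁ := by split_ifs <;> linarith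
    have i2 : (if s₁ + hi₁ < j' + 1 then p₁ else 0) ≤ p₁ := by split_ifs <;> linarith
    have hγ1' : 0 ≤ 1 - γ₁ := by linarith
    nlinarith [mul_le_mul_of_nonneg_left i1 hγ1', mul_le_mul_of_nonneg_left i2 hγ₁0, hq0]
  -- criterion E
  refine decAt_of_giantsAbsorbLows y j' (M₁ + M₂) P hjM n0 nM n1 hy0 ?_
  have hsplit := Finset.sum_range_add_sum_Ico P (show j' + 1 ≤ M₁ + M₂ + 1 by omega)
  rw [n1] at hsplit
  have hlows : ∑ h ∈ Finset.range (j' + 1),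
      (if 2 * (h : ℝ) < ∑ k ∈ Finset.range (M₁ + M₂ + 1), (k : ℝ) * P k then P h else 0) ≤ ∑ h ∈ Finset.range (j' + 1), P h :=
    Finset.sum_le_sum fun h _ => by split_ifs <;> linarith [n0 h]
  have hS : ∑ h ∈ Finset.range (j' + 1), P h ≤ 1 - y := by nlinarith
  nlinarith [hy0, hy1]

/-- **CELL PT ⟸ CW + THE SMALLER RESIDUAL** (`sgcLightPairTriple_of_windowMix_of_residual` with the residual further restricted to
`lo₁ + s₂ ≤ j′`, the giant layers being `sgcLightPairTriple_decAt_of_lt_lo_s₂`). [this work] -/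
theorem sgcLightPairTriple_of_windowMix_of_residual₂ (hCW : WindowMixDEC)
    (hR : ∀ (y q γ₁ p₁ p₂ p₃ T₂ : ℝ) (M₁ M₂ lo₁ hi₁ s₁ s₂ s₃ : ℕ),
      0 < y → y < 1 → 0 < q → q ≤ 1 →
      lo₁ < hi₁ → hi₁ ≤ M₁ → 0 ≤ γ₁ → γ₁ ≤ 1 → q * γ₁ < y →
      y * (M₁ : ℝ) ≤ q * ((lo₁ : ℝ) + ((hi₁ : ℝ) - lo₁) * γ₁) →
      (∀ j', j' < M₁ → DECAt y j' M₁ (gate (fun h => TP[lo₁, hi₁, γ₁, h]) q)) →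
      s₁ < s₂ → s₂ < s₃ → s₃ ≤ M₂ → 0 < p₁ → 0 < p₂ → 0 < p₃ → p₁ + p₂ + p₃ = 1 →
      p₁ * (s₁ : ℝ) + p₂ * (s₂ : ℝ) + p₃ * (s₃ : ℝ) = T₂ →
      y * (M₂ : ℝ) ≤ q * T₂ →
      ((s₂ : ℝ) ≤ T₂ ∧ q * (T₂ - s₂) < y * ((s₃ : ℝ) - s₂) ∨ T₂ < (s₂ : ℝ) ∧ q * (T₂ - s₁) < y * ((s₃ : ℝ) - s₁)) →
      (∀ j', j' < M₂ → DECAt y j' M₂ (gate (fun h => TR[s₁, s₂, s₃, p₁, p₂, p₃, h]) q)) →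
      ∀ j', j' < M₁ + M₂ → lo₁ + s₁ ≤ j' → lo₁ + s₂ ≤ j' →
        2 * ((lo₁ : ℝ) + s₁) < q * (((lo₁ : ℝ) + ((hi₁ : ℝ) - lo₁) * γ₁) + T₂) →
        (T₂ < (s₂ : ℝ) ∨ q * (T₂ - s₁) < y * ((s₃ : ℝ) - s₁) ∨
          (lo₁ + s₂ ≤ j' ∧ 2 * ((lo₁ : ℝ) + s₂) < q * (((lo₁ : ℝ) + ((hi₁ : ℝ) - lo₁) * γ₁) + T₂))) →
        DECAt y j' (M₁ + M₂)
          (gate (lconv M₁ M₂ (fun h => TP[lo₁, hi₁, γ₁, h]) (fun h => TR[s₁, s₂, s₃, p₁, p₂, p₃, h])) q)) :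
    SGCLightPairTriple := by
  refine sgcLightPairTriple_of_windowMix_of_residual hCW ?_
  intro y q γ₁ p₁ p₂ p₃ T₂ M₁ M₂ lo₁ hi₁ s₁ s₂ s₃ hy0 hy1 hq0 hq1 hlohi₁ hhi₁ hγ₁0 hγ₁1 hlight₁ hta₁ hD₁ h12 h23 h3 hp₁ hp₂ hp₃
    hp hT hta₂ hnotHD hD₂ j' hj' hj1 ht1 hdisj
  by_cases hj2 : j' < lo₁ + s₂
  · exact sgcLightPairTriple_decAt_of_lt_lo_s₂ y q γ₁ p₁ p₂ p₃ T₂ M₁ M₂ lo₁ hi₁ s₁ s₂ s₃ j' hy0 hy1 hq0 hq1 hlohi₁ hhi₁ hγ₁0 hγ₁1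
      hlight₁ hta₁ hD₁ h12 h23 h3 hp₁ hp₂ hp₃ hp hT hta₂ hD₂ hj2 hj'
  · exact hR y q γ₁ p₁ p₂ p₃ T₂ M₁ M₂ lo₁ hi₁ s₁ s₂ s₃ hy0 hy1 hq0 hq1 hlohi₁ hhi₁ hγ₁0 hγ₁1 hlight₁ hta₁ hD₁ h12 h23 h3 hp₁ hp₂
      hp₃ hp hT hta₂ hnotHD hD₂ j' hj' hj1 (not_lt.1 hj2) ht1 hdisj

end LawDec

end Quant

end Summit.CriticalPhenomena.PercolationContinuityZ3.Theorems
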